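import Summits.BirchSwinnertonDyer.Rank1Residual.ManinAdditive.PrimeShiftEqualiserLaw
import Summits.BirchSwinnertonDyer.BirchSwinnertonDyer.Theorems.ManinLocalTwoThreeNineShiftTowerReduction
import HarnessLib

/-!
# The FERMAT-QUOTIENT diamond character `q_p ∘ d` on `Γ₀(L)`, `p² ∣ L` — the one new `𝔽_p`-valued diamond class at depth `p²`
# (route `ManinLocalTwoThree`, cell bsd-f2-manin; absorber of the prime-generic `p`-power tower for the LEAD's law
# `ShiftEqualiser.PrimeShiftInvariantIsDiamond`, T-p1-g11-2; prover seat p3 gen 11)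

For an odd prime `p`, `Hom((ℤ/p^e)ˣ, 𝔽_p)` is `0` for `e ≤ 1` and one-dimensional for `e ≥ 2`, spanned by the FERMAT QUOTIENT
`q_p(d) = (d^{p−1} − 1)/p mod p` (`fq`; at `p = 2` it is the seat's `χ₄`).  This file proves the three elementary facts the
tower needs, for EVERY prime `p` (`Fact p.Prime`): `q_p(de) ≡ q_p(d) + q_p(e)` (`fq_mul`), `d' ≡ d (mod p²) ⟹ q_p(d') ≡ q_p(d)`
(`fq_congr`), `q_p(1 + pt) ≡ −t` (`fq_one_add_mul`); and packages `ψ = q_p ∘ d : Γ₀(L) → K` (`fqChar`, `K` of characteristic `p`)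
with: additive for `p² ∣ L` (`isAdd_fqChar`), a diamond class for `p² ∣ L` (`isDiamond_fqChar`), invariant under every shift
(`isShiftInvariant_fqChar`, trivially: the shift does not move `d`), and `ψ(γ) = −t` when `d_γ = 1 + pt` (`fqChar_eq_of_d_eq`).
HONEST FRAMING: elementary number theory; nothing about BSD, Manin's conjecture, C2/C3 or the LEAD's law is asserted.
Reference: HOME/p1/CENSUS-shift-equaliser-p1-g11.md (the `r_p((ℤ/N)ˣ)` bookkeeping) [cite: DarmonDiamondTaylor1995, Lemma 4.28 (p. 135)].
-/

set_option autoImplicit false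
set_option linter.dupNamespace false

open scoped MatrixGroups

open CongruenceSubgroup Matrix.SpecialLinearGroup
open Summit.BirchSwinnertonDyer.Rank1Residual.ManinAdditive.NineShiftEqualiser (slOf g0Of g0Of_congr)
open Summit.BirchSwinnertonDyer.Rank1Residual.ManinAdditive.ShiftEqualiser (IsAdd IsShiftInvariant IsDiamond)

namespace Summit.BirchSwinnertonDyer.BirchSwinnertonDyer.Theorems.ManinLocalTwoThree

namespace PrimeShift

/-! ### §1. The Fermat quotient -/

/-- The FERMAT QUOTIENT `q_p(d) = (d^{p−1} − 1)/p` (integer division; used for `p ∤ d`). [folklore] -/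
def fq (p : ℕ) (d : ℤ) : ℤ := (d ^ (p - 1) - 1) / p

section Fermat

variable {p : ℕ} [hp : Fact p.Prime]

/-- Fermat: `p ∣ d^{p−1} − 1` for `d` prime to `p`. [folklore] -/
theorem p_dvd_pow_sub_one {d : ℤ} (hd : IsCoprime d p) : (p : ℤ) ∣ d ^ (p - 1) - 1 :=
  (Int.ModEq.pow_card_sub_one_eq_one hp.out hd).symm.dvd

/-- `d^{p−1} = 1 + p·q_p(d)`. [folklore] -/
theorem pow_eq_one_add (d : ℤ) (hd : IsCoprime d p) : d ^ (p - 1) = 1 + p * fq p d := by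
  have := Int.mul_ediv_cancel' (p_dvd_pow_sub_one hd)
  unfold fq
  linear_combination -this

/-- **`q_p(de) ≡ q_p(d) + q_p(e) (mod p)`**. [folklore] -/
theorem fq_mul (d e : ℤ) (hd : IsCoprime d p) (he : IsCoprime e p) :
    (p : ℤ) ∣ fq p (d * e) - (fq p d + fq p e) := by
  have hp0 : (p : ℤ) ≠ 0 := by exact_mod_cast hp.out.ne_zero
  have h1 := pow_eq_one_add d hd
  have h2 := pow_eq_one_add e he
  have h3 := pow_eq_one_add (d * e) (IsCoprime.mul_left hd he)
  rw [mul_pow, h1, h2] at h3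
  have e4 : (p : ℤ) * (fq p d + fq p e + p * (fq p d * fq p e) - fq p (d * e)) = 0 := by linear_combination h3
  rcases mul_eq_zero.mp e4 with h | h
  · exact absurd h hp0
  · exact ⟨fq p d * fq p e, by linear_combination -h⟩

/-- **`d' ≡ d (mod p²) ⟹ q_p(d') ≡ q_p(d) (mod p)`**. [folklore] -/
theorem fq_congr (d d' : ℤ) (hd : IsCoprime d p) (h : (p : ℤ) ^ 2 ∣ d' - d) : (p : ℤ) ∣ fq p d' - fq p d := by
  have hp0 : (p : ℤ) ≠ 0 := by exact_mod_cast hp.out.ne_zero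
  obtain ⟨k, hk⟩ := h
  have hd' : IsCoprime d' p := by
    have e : d' = d + (p * k) * p := by linear_combination hk
    rw [e]
    exact hd.add_mul_right_left (p * k)
  have h1 := pow_eq_one_add d hd
  have h2 := pow_eq_one_add d' hd'
  have h3 : (p : ℤ) ^ 2 ∣ d' ^ (p - 1) - d ^ (p - 1) :=
    ((Int.modEq_iff_dvd.mpr ⟨k, hk⟩).pow (p - 1)).dvd
  rw [h1, h2, show (1 + (p : ℤ) * fq p d') - (1 + p * fq p d) = p * (fq p d' - fq p d) by ring, pow_two] at h3
  exact (mul_dvd_mul_iff_left hp0).mp h3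

omit hp in
/-- `q_p(1) = 0`. [folklore] -/
theorem fq_one : fq p 1 = 0 := by simp [fq]

/-- `(1 + x)^k = 1 + kx + x²R`. [folklore] -/
theorem exists_one_add_pow (x : ℤ) (k : ℕ) : ∃ R : ℤ, (1 + x) ^ k = 1 + k * x + x * x * R := by
  induction k with
  | zero => exact ⟨0, by simp⟩
  | succ k ih =>
      obtain ⟨R, hR⟩ := ih
      exact ⟨k + R + x * R, by rw [pow_succ, hR]; push_cast; ring⟩

/-- **`q_p(1 + pt) ≡ −t (mod p)`**. [folklore] -/
theorem fq_one_add_mul (t : ℤ) : (p : ℤ) ∣ fq p (1 + p * t) + t := by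
  have hp0 : (p : ℤ) ≠ 0 := by exact_mod_cast hp.out.ne_zero
  have hcop : IsCoprime (1 + p * t) (p : ℤ) := by
    rw [show (1 : ℤ) + p * t = 1 + t * p by ring]
    exact isCoprime_one_left.add_mul_right_left t
  have h1 := pow_eq_one_add (1 + p * t) hcop
  obtain ⟨R, hR⟩ := exists_one_add_pow (p * t) (p - 1)
  rw [h1, Nat.cast_pred hp.out.pos] at hR
  have e : (p : ℤ) * (fq p (1 + p * t) + t - p * (t + t * t * R)) = 0 := by linear_combination hR
  rcases mul_eq_zero.mp e with h | h
  · exact absurd h hp0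
  · exact ⟨t + t * t * R, by linear_combination h⟩

end Fermat

/-! ### §2. The character `ψ = q_p ∘ d` on `Γ₀(L)`, `p² ∣ L` -/

section Character

variable (K : Type*) [CommRing K] (p : ℕ) [hp : Fact p.Prime] [CharP K p] {L : ℕ}

/-- The Fermat-quotient diamond character `ψ(γ) = q_p(d_γ)` with values in `K` (characteristic `p`). [folklore] -/
def fqChar (γ : Gamma0 L) : K := ((fq p ((γ : SL(2, ℤ)) 1 1) : ℤ) : K)

variable {K p}

omit hp in
/-- Casting kills multiples of `p`. [folklore] -/
theorem intCast_eq_of_dvd {x y : ℤ} (h : (p : ℤ) ∣ x - y) : (x : K) = (y : K) :=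
  (CharP.intCast_eq_intCast K p).mpr (Int.modEq_iff_dvd.mpr (by obtain ⟨k, hk⟩ := h; exact ⟨-k, by linear_combination -hk⟩))

omit hp [CharP K p] in
/-- The `d`-entry of an element of `Γ₀(L)`, `p ∣ L`, is prime to `p`. [folklore] -/
theorem isCoprime_d (hpL : (p : ℤ) ∣ L) (γ : Gamma0 L) : IsCoprime ((γ : SL(2, ℤ)) 1 1 : ℤ) (p : ℤ) := by
  obtain ⟨c₁, hc₁⟩ := hpL.trans ((ZMod.intCast_zmod_eq_zero_iff_dvd _ L).mp (Gamma0_mem.mp γ.2))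
  exact ⟨(γ : SL(2, ℤ)) 0 0, -((γ : SL(2, ℤ)) 0 1 * c₁), by linear_combination gamma0_det_entries γ + ((γ : SL(2, ℤ)) 0 1 : ℤ) * hc₁⟩

/-- **`ψ` is additive on `Γ₀(L)` for `p² ∣ L`** (`(γδ)_d ≡ d_γ d_δ (mod p²)`). [folklore] -/
theorem isAdd_fqChar (hL : p ^ 2 ∣ L) : IsAdd (fqChar K p : Gamma0 L → K) := by
  intro γ δ
  have hpL : (p : ℤ) ∣ L := (show (p : ℤ) ∣ (p : ℤ) ^ 2 from ⟨p, by ring⟩).trans (by exact_mod_cast hL)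
  have hγ := isCoprime_d hpL γ
  have hδ := isCoprime_d hpL δ
  unfold fqChar
  have e : (((γ * δ : Gamma0 L) : SL(2, ℤ)) 1 1 : ℤ) = (γ : SL(2, ℤ)) 1 0 * (δ : SL(2, ℤ)) 0 1 + (γ : SL(2, ℤ)) 1 1 * (δ : SL(2, ℤ)) 1 1 := by
    simp [Matrix.mul_apply, Fin.sum_univ_two]
  have hc : (p : ℤ) ^ 2 ∣ (γ : SL(2, ℤ)) 1 0 :=
    (show (p : ℤ) ^ 2 ∣ (L : ℤ) by exact_mod_cast hL).trans ((ZMod.intCast_zmod_eq_zero_iff_dvd _ L).mp (Gamma0_mem.mp γ.2))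
  have h1 : (p : ℤ) ∣ fq p (((γ * δ : Gamma0 L) : SL(2, ℤ)) 1 1) - fq p ((γ : SL(2, ℤ)) 1 1 * (δ : SL(2, ℤ)) 1 1) :=
    fq_congr _ _ (IsCoprime.mul_left hγ hδ) (by rw [e]; simpa using Dvd.dvd.mul_right hc _)
  rw [intCast_eq_of_dvd h1, intCast_eq_of_dvd (fq_mul _ _ hγ hδ)]
  push_cast
  rfl

/-- **`ψ` is a diamond class on `Γ₀(L)` for `p² ∣ L`** (`d ≡ 1 (mod L)` ⟹ `q_p(d) ≡ q_p(1) = 0`). [folklore] -/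
theorem isDiamond_fqChar (hL : p ^ 2 ∣ L) : IsDiamond (fqChar K p : Gamma0 L → K) := by
  intro γ hγ
  obtain ⟨-, h11, -⟩ := (Gamma1_mem L γ).mp hγ
  have hd : (L : ℤ) ∣ (γ 1 1 : ℤ) - 1 := by
    rw [← ZMod.intCast_zmod_eq_zero_iff_dvd]
    push_cast
    rw [h11, sub_self]
  have h1 : (p : ℤ) ∣ fq p (γ 1 1 : ℤ) - fq p 1 :=
    fq_congr 1 _ isCoprime_one_left ((show (p : ℤ) ^ 2 ∣ (L : ℤ) by exact_mod_cast hL).trans hd)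
  unfold fqChar
  rw [show (((⟨γ, Gamma1_in_Gamma0 L hγ⟩ : Gamma0 L) : SL(2, ℤ)) 1 1 : ℤ) = γ 1 1 from rfl, intCast_eq_of_dvd h1, fq_one,
    Int.cast_zero]

omit hp [CharP K p] in
/-- `ψ` is invariant under EVERY shift (the shift does not move the `d`-entry). [folklore] -/
theorem isShiftInvariant_fqChar (t : ℤ) : IsShiftInvariant t (fqChar K p : Gamma0 L → K) := fun _ _ _ _ _ _ => rfl

/-- The value of `ψ` at an element with `d = 1 + pt` is `−t`. [folklore] -/
theorem fqChar_eq_of_d_eq (γ : Gamma0 L) (t : ℤ) (hd : ((γ : SL(2, ℤ)) 1 1 : ℤ) = 1 + p * t) :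
    fqChar K p γ = -(t : K) := by
  unfold fqChar
  rw [hd, ← Int.cast_neg]
  exact intCast_eq_of_dvd (by simpa using fq_one_add_mul (p := p) t)

end Character

end PrimeShift

end Summit.BirchSwinnertonDyer.BirchSwinnertonDyer.Theorems.ManinLocalTwoThree
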